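import Mathlib.Combinatorics.SetFamily.FourFunctions
import Literature.Probability.LatticeModels.GriffithsMonotonicity
import HarnessLib

/-!
# The FKG inequality for the finite-volume Ising model, proved

Topic `Probability/LatticeModels`. The tree's named fact `ising_fkg` (`CorrelationInequalities`:
Fortuin–Kasteleyn–Ginibre, Comm. Math. Phys. **22** (1971) 89; Friedli–Velenik 2017, Thm. 3.21)
is **discharged** (`Literature.Probability.LatticeModels.ising_fkg_holds`): for `β ≥ 0`, every field `h ∈ ℝ`, every
boundary condition and all nondecreasing measurable observables `f, g`,
`⟨f g⟩^{bc}_{Λ;β,h} ≥ ⟨f⟩⟨g⟩`.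

Proof as in Fortuin–Kasteleyn–Ginibre 1971 / Friedli–Velenik §3.8.3 (Thm. 3.21 via the FKG
lattice condition, their eq. (3.53)): the finite-volume Gibbs weights `w(τ) = e^{-β ℋ(τ)}` on
the distributive lattice `{−1,+1}^Λ` satisfy `w(τ) w(τ') ≤ w(τ ∧ τ') w(τ ∨ τ')`, because
`-ℋ = ∑_{edges} σ_uσ_v + h ∑ σ_x` (boundary spins frozen) is supermodular: each `σ_uσ_v` is
supermodular on `{±1}²` (`spin_mul_supermodular`) and the one-body terms are modular; the
abstract FKG inequality for log-supermodular weights on a finite distributive lattice is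
Mathlib's `fkg` (a corollary of the Ahlswede–Daykin four functions theorem), applied to the
nonnegative shifts `f ∘ glue + C`, `g ∘ glue + C'` (the covariance is shift invariant).

## References

* C. M. Fortuin, P. W. Kasteleyn, J. Ginibre, *Correlation inequalities on some partially
  ordered sets*, Comm. Math. Phys. 22 (1971) 89–103 (bib key `FortuinKasteleynGinibre1971`).
* S. Friedli, Y. Velenik, *Statistical Mechanics of Lattice Systems* (CUP 2017), Thm. 3.21 and
  §3.8.3 (FKG lattice condition).
* Mathlib: `Mathlib.Combinatorics.SetFamily.FourFunctions` (`four_functions_theorem`, `fkg`).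
-/

noncomputable section

open MeasureTheory Filter Topology Finset Literature.Probability.LatticeModels Literature.Probability.Percolation

namespace Literature.Probability.LatticeModels

/-! ### Supermodularity of the Ising energy on `{−1,+1}^V` -/

section Lattice

variable {V : Type*}

/-- The spins `ℤˣ = {−1, +1}` ordered by `-1 < 1`: `σ_uσ_v` is supermodular,
`ab + a'b' ≤ (a∧a')(b∧b') + (a∨a')(b∨b')` (integer form, decided by cases). [cite: FriedliVelenik2017, §3.8.3] -/
theorem spin_mul_supermodular_int (a a' b b' : ℤˣ) :
    (a : ℤ) * b + (a' : ℤ) * b' ≤ ((a ⊓ a' : ℤˣ) : ℤ) * ((b ⊓ b' : ℤˣ) : ℤ) +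
      ((a ⊔ a' : ℤˣ) : ℤ) * ((b ⊔ b' : ℤˣ) : ℤ) := by
  revert a a' b b'
  decide

/-- Real form of `spin_mul_supermodular_int`. [cite: FriedliVelenik2017, §3.8.3] -/
theorem spin_mul_supermodular (a a' b b' : ℤˣ) :
    ((a : ℤ) : ℝ) * ((b : ℤ) : ℝ) + ((a' : ℤ) : ℝ) * ((b' : ℤ) : ℝ) ≤
      (((a ⊓ a' : ℤˣ) : ℤ) : ℝ) * (((b ⊓ b' : ℤˣ) : ℤ) : ℝ) +
        (((a ⊔ a' : ℤˣ) : ℤ) : ℝ) * (((b ⊔ b' : ℤˣ) : ℤ) : ℝ) := by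
  exact_mod_cast spin_mul_supermodular_int a a' b b'

/-- One-body terms are modular: `a + a' = (a ∧ a') + (a ∨ a')` in a chain. [folklore] -/
theorem spin_add_modular_int (a a' : ℤˣ) :
    (a : ℤ) + (a' : ℤ) = ((a ⊓ a' : ℤˣ) : ℤ) + ((a ⊔ a' : ℤˣ) : ℤ) := by
  revert a a'
  decide

/-- `σ_x(σ) + σ_x(σ') = σ_x(σ ∧ σ') + σ_x(σ ∨ σ')`. [folklore] -/
theorem spinAt_add_modular (x : V) (σ σ' : SpinConfig V) :
    spinAt x σ + spinAt x σ' = spinAt x (σ ⊓ σ') + spinAt x (σ ⊔ σ') := by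
  simp only [spinAt, Pi.inf_apply, Pi.sup_apply]
  exact_mod_cast spin_add_modular_int (σ x) (σ' x)

/-- `σ_e(σ) + σ_e(σ') ≤ σ_e(σ ∧ σ') + σ_e(σ ∨ σ')` for every bond `e`. [cite: FriedliVelenik2017, §3.8.3] -/
theorem bondSpin_supermodular (e : Sym2 V) (σ σ' : SpinConfig V) :
    bondSpin σ e + bondSpin σ' e ≤ bondSpin (σ ⊓ σ') e + bondSpin (σ ⊔ σ') e := by
  induction e using Sym2.ind with
  | _ u v =>
    simp only [bondSpin_mk, spinAt, Pi.inf_apply, Pi.sup_apply]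
    exact spin_mul_supermodular (σ u) (σ' u) (σ v) (σ' v)

variable (G : SimpleGraph V) [DecidableEq V] [G.LocallyFinite]

/-- **The Ising energy is supermodular**: `-ℋ(σ) - ℋ(σ') ≤ -ℋ(σ ∧ σ') - ℋ(σ ∨ σ')` for every
volume, field `h ∈ ℝ` and boundary condition (Friedli–Velenik 2017, §3.8.3: the Ising model
satisfies the FKG lattice condition). [cite: FriedliVelenik2017, §3.8.3] -/
theorem neg_isingHamiltonian_supermodular (Λ : Finset V) (h : ℝ) (bc : BoundaryCondition V)
    (σ σ' : SpinConfig V) :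
    -isingHamiltonian G Λ h bc σ + -isingHamiltonian G Λ h bc σ' ≤
      -isingHamiltonian G Λ h bc (σ ⊓ σ') + -isingHamiltonian G Λ h bc (σ ⊔ σ') := by
  have hE : ∑ e ∈ interactionEdges G Λ bc, bondSpin σ e + ∑ e ∈ interactionEdges G Λ bc, bondSpin σ' e ≤
      ∑ e ∈ interactionEdges G Λ bc, bondSpin (σ ⊓ σ') e +
        ∑ e ∈ interactionEdges G Λ bc, bondSpin (σ ⊔ σ') e := by
    rw [← Finset.sum_add_distrib, ← Finset.sum_add_distrib]
    exact Finset.sum_le_sum fun e _ => bondSpin_supermodular e σ σ'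
  have hS : ∑ x ∈ Λ, spinAt x σ + ∑ x ∈ Λ, spinAt x σ' =
      ∑ x ∈ Λ, spinAt x (σ ⊓ σ') + ∑ x ∈ Λ, spinAt x (σ ⊔ σ') := by
    rw [← Finset.sum_add_distrib, ← Finset.sum_add_distrib]
    exact Finset.sum_congr rfl fun x _ => spinAt_add_modular x σ σ'
  simp only [isingHamiltonian, neg_sub, sub_neg_eq_add]
  have := congrArg (fun t => h * t) hS
  simp only [mul_add] at this
  linarith

/-- `glue` commutes with `∧`. [folklore] -/
theorem glue_inf (Λ : Finset V) (τ τ' : Λ → ℤˣ) (bc : BoundaryCondition V) :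
    glue Λ (τ ⊓ τ') bc = glue Λ τ bc ⊓ glue Λ τ' bc := by
  funext x
  by_cases hx : x ∈ Λ
  · simp [glue_apply_of_mem Λ _ bc hx]
  · simp [glue_apply_of_notMem Λ _ bc hx]

/-- `glue` commutes with `∨`. [folklore] -/
theorem glue_sup (Λ : Finset V) (τ τ' : Λ → ℤˣ) (bc : BoundaryCondition V) :
    glue Λ (τ ⊔ τ') bc = glue Λ τ bc ⊔ glue Λ τ' bc := by
  funext x
  by_cases hx : x ∈ Λ
  · simp [glue_apply_of_mem Λ _ bc hx]
  · simp [glue_apply_of_notMem Λ _ bc hx]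

/-- `τ ↦ glue Λ τ bc` is monotone. [folklore] -/
theorem glue_monotone (Λ : Finset V) (bc : BoundaryCondition V) :
    Monotone fun τ : Λ → ℤˣ => glue Λ τ bc := by
  intro τ τ' hle x
  by_cases hx : x ∈ Λ
  · simpa [glue_apply_of_mem Λ _ bc hx] using hle ⟨x, hx⟩
  · simp [glue_apply_of_notMem Λ _ bc hx]

/-- **The FKG lattice condition for the Ising weights** (Friedli–Velenik 2017, eq. (3.53) /
§3.8.3): for `β ≥ 0`, `w(τ) w(τ') ≤ w(τ ∧ τ') w(τ ∨ τ')`. [cite: FriedliVelenik2017, §3.8.3, eq. (3.53)] -/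
theorem isingWeight_lattice_condition (Λ : Finset V) {β : ℝ} (hβ : 0 ≤ β) (h : ℝ)
    (bc : BoundaryCondition V) (τ τ' : Λ → ℤˣ) :
    isingWeight G Λ β h bc τ * isingWeight G Λ β h bc τ' ≤
      isingWeight G Λ β h bc (τ ⊓ τ') * isingWeight G Λ β h bc (τ ⊔ τ') := by
  simp only [isingWeight, ← Real.exp_add, glue_inf, glue_sup]
  refine Real.exp_le_exp.2 ?_
  have := neg_isingHamiltonian_supermodular G Λ h bc (glue Λ τ bc) (glue Λ τ' bc)
  nlinarith

end Lattice

end Literature.Probability.LatticeModels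

namespace Literature.Probability.LatticeModels

open Percolation

variable {V : Type*} (G : SimpleGraph V) [DecidableEq V] [G.LocallyFinite] {β : ℝ}

/-- **The FKG inequality for the finite-volume Ising model, proved** (the tree's named fact
`ising_fkg`: Fortuin–Kasteleyn–Ginibre 1971; Friedli–Velenik 2017, Thm. 3.21): for `β ≥ 0`,
any `h ∈ ℝ`, any boundary condition and nondecreasing measurable `f, g`,
`⟨f⟩^{bc}_{Λ;β,h} ⟨g⟩^{bc}_{Λ;β,h} ≤ ⟨f g⟩^{bc}_{Λ;β,h}`. From the lattice condition
(`isingWeight_lattice_condition`) and the abstract FKG inequality on the finite distributive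
lattice `{−1,+1}^Λ` (Mathlib `fkg`, via the four functions theorem), applied to the
nonnegative, nondecreasing shifted observables `f ∘ glue + C`, `g ∘ glue + C'`. [cite: FriedliVelenik2017, Thm. 3.21] -/
theorem ising_fkg_holds : ising_fkg G (β := β) := by
  intro hβ Λ h bc f g hf hg hfm hgm
  classical
  set w : (Λ → ℤˣ) → ℝ := isingWeight G Λ β h bc with hw
  set F : (Λ → ℤˣ) → ℝ := fun τ => f (glue Λ τ bc) with hF
  set Gg : (Λ → ℤˣ) → ℝ := fun τ => g (glue Λ τ bc) with hGg
  have hFm : Monotone F := fun τ τ' hle => hf (glue_monotone Λ bc hle)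
  have hGm : Monotone Gg := fun τ τ' hle => hg (glue_monotone Λ bc hle)
  -- nonnegative shifts
  set C₁ : ℝ := ∑ τ, |F τ| with hC₁
  set C₂ : ℝ := ∑ τ, |Gg τ| with hC₂
  have hF0 : 0 ≤ fun τ => F τ + C₁ := fun τ => by
    have h1 : |F τ| ≤ C₁ :=
      Finset.single_le_sum (f := fun τ => |F τ|) (fun _ _ => abs_nonneg _) (Finset.mem_univ τ)
    simp only [Pi.zero_apply]
    linarith [neg_abs_le (F τ)]
  have hG0 : 0 ≤ fun τ => Gg τ + C₂ := fun τ => by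
    have h1 : |Gg τ| ≤ C₂ :=
      Finset.single_le_sum (f := fun τ => |Gg τ|) (fun _ _ => abs_nonneg _) (Finset.mem_univ τ)
    simp only [Pi.zero_apply]
    linarith [neg_abs_le (Gg τ)]
  have hw0 : 0 ≤ w := fun τ => (isingWeight_pos G Λ β h bc τ).le
  have key := fkg (fun τ => F τ + C₁) (fun τ => Gg τ + C₂) w hw0 hF0 hG0
    (hFm.add_const C₁) (hGm.add_const C₂)
    (fun a b => isingWeight_lattice_condition G Λ hβ h bc a b)
  -- the sums
  set Z : ℝ := ∑ τ, w τ with hZdef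
  set Sf : ℝ := ∑ τ, w τ * F τ with hSf
  set Sg : ℝ := ∑ τ, w τ * Gg τ with hSg
  set Sfg : ℝ := ∑ τ, w τ * (F τ * Gg τ) with hSfg
  have hZ : 0 < Z := Finset.sum_pos (fun τ _ => isingWeight_pos G Λ β h bc τ) Finset.univ_nonempty
  have e1 : ∑ τ, w τ * (F τ + C₁) = Sf + C₁ * Z := by
    simp only [mul_add, Finset.sum_add_distrib, hSf, hZdef, Finset.mul_sum]
    congr 1
    exact Finset.sum_congr rfl fun τ _ => by ring
  have e2 : ∑ τ, w τ * (Gg τ + C₂) = Sg + C₂ * Z := by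
    simp only [mul_add, Finset.sum_add_distrib, hSg, hZdef, Finset.mul_sum]
    congr 1
    exact Finset.sum_congr rfl fun τ _ => by ring
  have e3 : ∑ τ, w τ * ((F τ + C₁) * (Gg τ + C₂)) = Sfg + C₂ * Sf + C₁ * Sg + C₁ * C₂ * Z := by
    simp only [hSfg, hSf, hSg, hZdef, Finset.mul_sum, ← Finset.sum_add_distrib]
    exact Finset.sum_congr rfl fun τ _ => by ring
  rw [e1, e2, e3] at key
  have hmain : Sf * Sg ≤ Sfg * Z := by nlinarith
  -- back to expectations
  have hexpF : isingExpect G Λ β h bc f = Sf / Z := by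
    rw [isingExpect_eq_sum_div G Λ h bc β hfm]; rfl
  have hexpG : isingExpect G Λ β h bc g = Sg / Z := by
    rw [isingExpect_eq_sum_div G Λ h bc β hgm]; rfl
  have hexpFG : isingExpect G Λ β h bc (f * g) = Sfg / Z := by
    rw [isingExpect_eq_sum_div G Λ h bc β (hfm.mul hgm)]; rfl
  rw [hexpF, hexpG, hexpFG, div_mul_div_comm, div_le_div_iff₀ (mul_pos hZ hZ) hZ]
  nlinarith [mul_le_mul_of_nonneg_right hmain hZ.le]

end Literature.Probability.LatticeModels
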